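import Literature.MathematicalPhysics.QuantumLattice.KomaPiFluxSpontaneousOrder
import Literature.MathematicalPhysics.QuantumLattice.KomaPiFluxGroundStateKLSBound
import Literature.MathematicalPhysics.QuantumLattice.KomaPiFluxKuboInequality
import Literature.MathematicalPhysics.QuantumLattice.XYZGroundStateOrderIntegral
import HarnessLib

/-!
# Koma's `π`-flux BCS model in TWO dimensions at zero temperature: ground-state pairing long-range order
# (KLS route) and the spontaneous order under an infinitesimal field (Koma 2022 (2.15) in `d = 2`)

T. Koma, arXiv:2201.13135 (2022) [Koma2022] proves Theorem 2.1 (superconducting long-range order) for `d ≥ 3`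
at low temperature by reflection positivity and the infrared bound.  In two dimensions at `T = 0` the same model is
controlled by the genuinely pointwise ground-state route of T. Kennedy, E. H. Lieb, B. S. Shastry,
*The XY model has long-range order for all spins and all dimensions*, Phys. Rev. Lett. 61 (1988) 2582 [KLS1988PRL],
eqs. (4)–(8) with Kubo's inequality — all of whose steps are tree theorems of the `KomaPiFlux` series
(`KomaPiFlux.ground_kls_bound`, `KomaPiFlux.kubo_inequality`, `KomaPiFlux.groundNnCorr_ge`), the two-dimensional
lattice constant being the tree's certified `klsRiemannSum_two_eventually_le` (`R_L(2) ≤ 0.651` eventually,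
`XYZGroundStateOrderIntegral.lean`; `15√2/64 + 1/π = 0.6498…`).

* `KomaPiFlux.groundLroSq_neg_kappa`, `KomaPiFlux.ground_kls_bound'` (Kubo's inequality discharged:
  `e₁ ≤ m² + R_L√{e₁}₊ + 2√(κ/g)R_L`, every `d`);
* **`KomaPiFlux.groundState_superconductingOrder_two`**: `d = 2`, `T = 0`, Lieb frame `H₀ = hamiltonian κ U g 0 0`:
  for `g > 0`, `|κ| ≤ g/2000`, `U + 4g ≤ 0` there is `k₀` with `groundLroSq H₀ ≥ 1/125` on every torus `(ℤ/2kℤ)²`,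
  `k ≥ k₀`; **`KomaPiFlux.groundState_superconductingOrder_two_sharp`**: `|κ| ≤ g/10000` ⟹ `groundLroSq H₀ ≥ 1/40`;
  `KomaPiFlux.printed_groundState_superconductingOrder_two`: for the printed Hamiltonian (2.4)–(2.9) in `d = 2`
  (`U = -4g`), `|κ| ≤ g/2000`, the zero-temperature limit of Koma's `m^{(Λ)}_LRO` (2.11) exists and is `≥ 2/25`;
* **`KomaPiFlux.spontaneousOrder_two`** — (2.15) in two dimensions at `T = 0`: for `|κ| ≤ g/2000`, `U + 4g ≤ 0`, every
  `B > 0`, `ε > 0`, on all large even tori EVERY unit ground state `Φ_B` of `H₀ - B·Σ_xΓ²_x` has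
  `|Λ|⁻¹ Re Φ_B†(Σ_xΓ²_x)Φ_B ≥ 4/√1000 - ε` (`√2σ` with `σ² = 1/125`), by the engine
  `KomaPiFlux.spontaneousOrder_of_groundLroSq` (KT93 Theorem 7.3 ∘ the instance `ktSystem`);
  `spontaneousOrder_two_zeroTemperature` ((2.13) form) and **`printed_spontaneousOrder_two`** (printed frame).

Scalar endgame (no numerics): `e₁ ≥ ½ - 4κ/g`, `R_L ≤ 0.651`, `√(κ/g) ≤ t₀`, and `e₁ ≤ m² + R_L√e₁ + 2√(κ/g)R_L`
force `m² ≥ (s₀² - 0.651 s₀) - 1.302 t₀` with `s₀ = √(½ - 4κ/g)`: `0.0094 ≥ 1/125` at `κ/g ≤ 1/2000`,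
`0.0264 ≥ 1/40` at `κ/g ≤ 10⁻⁴`.  A model-side twin of these statements (the weaker window `|κ| ≤ g/10000 ⟹ 1/250`,
with `R_L ≤ 0.68`) is the problem-side leaf `Summits/…/Theorems/KomaPiFluxGroundStateLRO2D.lean` of cell
`pub/hubbard-cq` (K2D); this file is its Literature form with the sharper tree constant.  Sibling-model statement:
NOT a statement about the Hubbard model.  No named facts; every statement is proved.

## References

* [Koma2022] T. Koma, arXiv:2201.13135, Theorem 2.1, (2.4)–(2.15), §6.
* [KLS1988PRL] T. Kennedy, E. H. Lieb, B. S. Shastry, Phys. Rev. Lett. 61 (1988) 2582, eqs. (4)–(8) and the remark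
  after (4) (Kubo's inequality `e₃ ≥ -e₁`).
* [KomaTasaki1993] T. Koma, H. Tasaki, Commun. Math. Phys. 158 (1993) 191–214, Theorem 7.3.
* [BjornbergUeltschi2022] J. E. Björnberg, D. Ueltschi, arXiv:2204.12896, Table 1 (`Ĩ⁽²⁾ = 0.6468`).
-/

noncomputable section

namespace Literature.MathematicalPhysics.QuantumLattice

open _root_.Matrix Finset Filter Topology HubbardWave0 PairHopRP FermionTorus LiebCutRP WithLp
open Literature.Probability.LatticeModels
open scoped Matrix.Norms.L2Operator InnerProductSpace ComplexConjugate ComplexOrder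

namespace KomaPiFlux

attribute [local instance] LiebCutRP.decEqTorus

open KT

/-! ### The scalar endgames -/

/-- `e ≥ 0.498`, `R ≤ 0.651`, `0 ≤ t ≤ 0.0224` and `e ≤ m + R√{e}₊ + 2tR` force `m ≥ 1/125`.
[cite: KLS1988PRL, after eq. (8)] -/
private theorem margin_two {e m R t : ℝ} (he : 0.498 ≤ e) (hR : R ≤ 0.651) (ht : t ≤ 0.0224) (ht0 : 0 ≤ t)
    (h : e ≤ m + R * Real.sqrt (max e 0) + 2 * t * R) : 1 / 125 ≤ m := by
  have he0 : 0 ≤ e := by linarith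
  rw [max_eq_left he0] at h
  have hs0 : 0 ≤ Real.sqrt e := Real.sqrt_nonneg e
  have hse : Real.sqrt e ^ 2 = e := Real.sq_sqrt he0
  have hs1 : 0.70569 ≤ Real.sqrt e := by
    rw [Real.le_sqrt' (by norm_num)]
    linarith
  have hRs : R * Real.sqrt e ≤ 0.651 * Real.sqrt e := mul_le_mul_of_nonneg_right hR hs0
  have htR : 2 * t * R ≤ 2 * 0.0224 * 0.651 := by nlinarith
  have hp : 0 ≤ (Real.sqrt e - 0.70569) * (Real.sqrt e + 0.05469) := mul_nonneg (by linarith) (by linarith)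
  nlinarith

/-- `e ≥ 0.4996`, `R ≤ 0.651`, `0 ≤ t ≤ 1/100` and `e ≤ m + R√{e}₊ + 2tR` force `m ≥ 1/40`.
[cite: KLS1988PRL, after eq. (8)] -/
private theorem margin_two_sharp {e m R t : ℝ} (he : 0.4996 ≤ e) (hR : R ≤ 0.651) (ht : t ≤ 1 / 100) (ht0 : 0 ≤ t)
    (h : e ≤ m + R * Real.sqrt (max e 0) + 2 * t * R) : 1 / 40 ≤ m := by
  have he0 : 0 ≤ e := by linarith
  rw [max_eq_left he0] at h
  have hs0 : 0 ≤ Real.sqrt e := Real.sqrt_nonneg e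
  have hse : Real.sqrt e ^ 2 = e := Real.sq_sqrt he0
  have hs1 : 0.70682 ≤ Real.sqrt e := by
    rw [Real.le_sqrt' (by norm_num)]
    linarith
  have hRs : R * Real.sqrt e ≤ 0.651 * Real.sqrt e := mul_le_mul_of_nonneg_right hR hs0
  have htR : 2 * t * R ≤ 2 * (1 / 100) * 0.651 := by nlinarith
  have hp : 0 ≤ (Real.sqrt e - 0.70682) * (Real.sqrt e + 0.05582) := mul_nonneg (by linarith) (by linarith)
  nlinarith

/-! ### The KLS ground-state bound with Kubo's inequality discharged -/

/-- `groundLroSq` is even in `κ` (limit of `lroSq_neg_kappa`). [cite: Koma2022, (2.7)–(2.9), §4.1] -/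
theorem groundLroSq_neg_kappa {d L : ℕ} [NeZero L] (hL : Even L) (h2 : 2 ≤ L) (κ U g : ℝ) :
    groundLroSq (hamiltonian (-κ) U g (fun (_ _ : FermionTorus (d + 1) L) => (0 : ℝ)) 0) =
      groundLroSq (hamiltonian κ U g (fun (_ _ : FermionTorus (d + 1) L) => (0 : ℝ)) 0) := by
  have hH1 : (hamiltonian (-κ) U g (fun (_ _ : FermionTorus (d + 1) L) => (0 : ℝ)) 0).IsHermitian :=
    hamiltonian_isHermitian (G d L) (piFluxAmpl (-κ)) (piFluxAmpl_herm (-κ)) U g _ 0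
  have hH2 : (hamiltonian κ U g (fun (_ _ : FermionTorus (d + 1) L) => (0 : ℝ)) 0).IsHermitian :=
    hamiltonian_isHermitian (G d L) (piFluxAmpl κ) (piFluxAmpl_herm κ) U g _ 0
  exact tendsto_nhds_unique (tendsto_lroSq_atTop hH1)
    ((tendsto_lroSq_atTop hH2).congr fun β => (lroSq_neg_kappa hL h2 β κ U g).symm)

/-- **The KLS ground-state bound, unconditional** (Kubo's inequality `e₃ ≥ -e₁` discharged by
`KomaPiFlux.kubo_inequality`): `e₁ ≤ m² + R_L√{e₁}₊ + 2√(κ/g)R_L` for `H₀ = H(κ,U;g,0;0)`, `κ ≥ 0`, `g > 0`,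
even `L ≥ 4`, every `d`. [cite: KLS1988PRL, eqs. (4)–(7)] [cite: Koma2022, §6] -/
theorem ground_kls_bound' {d L : ℕ} [NeZero L] (hL : Even L) (h4 : 4 ≤ L) {κ : ℝ} (hκ : 0 ≤ κ) (U : ℝ) {g : ℝ}
    (hg : 0 < g) :
    groundNnCorr (hamiltonian κ U g (fun (_ _ : FermionTorus (d + 1) L) => (0 : ℝ)) 0) ≤
      groundLroSq (hamiltonian κ U g (fun (_ _ : FermionTorus (d + 1) L) => (0 : ℝ)) 0) +
        klsRiemannSum (d + 1) L *
          Real.sqrt (max (groundNnCorr (hamiltonian κ U g (fun (_ _ : FermionTorus (d + 1) L) => (0 : ℝ)) 0)) 0) +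
        2 * Real.sqrt (κ / g) * klsRiemannSum (d + 1) L := by
  refine ground_kls_bound hL h4 hκ U hg ?_
  convert kubo_inequality (d := d) (L := L) hL (by omega : 3 ≤ L) κ U hg

/-! ### Two dimensions, `T = 0`: long-range order -/

/-- The two-dimensional endgame at `κ ≥ 0`: `R_L ≤ 0.651`, `κ/g ≤ r₀` with `4r₀ ≤ ½ - e₀` … packaged as: from the
pointwise KLS bound, `e₁ ≥ ½ - 4κ/g` and the scalar lemma. [cite: KLS1988PRL, eqs. (4)–(8)] -/
private theorem two_dim_core {κ U g : ℝ} (hg : 0 < g) (hκ : 0 ≤ κ) (hU : U + 4 * g ≤ 0) {c : ℝ}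
    (hmargin : ∀ {e m R t : ℝ}, 1 / 2 - 4 * κ / g ≤ e → R ≤ 0.651 → t ≤ Real.sqrt (κ / g) → 0 ≤ t →
      e ≤ m + R * Real.sqrt (max e 0) + 2 * t * R → c ≤ m) :
    ∃ k₀ : ℕ, ∀ k : ℕ, k₀ ≤ k → ∀ [NeZero (2 * k)],
      c ≤ groundLroSq (hamiltonian κ U g (fun (_ _ : FermionTorus (1 + 1) (2 * k)) => (0 : ℝ)) 0) := by
  obtain ⟨L₀, hL₀⟩ := Filter.eventually_atTop.1 klsRiemannSum_two_eventually_le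
  refine ⟨max L₀ 2, fun k hk _ => ?_⟩
  have hk2 : 2 ≤ k := le_trans (le_max_right _ _) hk
  have hL4 : 4 ≤ 2 * k := by omega
  have hR : klsRiemannSum (1 + 1) (2 * k) ≤ 0.651 := by
    have h := hL₀ (2 * k) (by omega)
    norm_num at h ⊢
    exact h
  have hkls := ground_kls_bound' (d := 1) (L := 2 * k) (even_two_mul k) hL4 hκ U hg
  have hlow := groundNnCorr_ge (d := 1) (L := 2 * k) (even_two_mul k) hL4 hκ U hg
  have hm0 : max (U + 2 * g * ((1 : ℕ) + 1 : ℝ)) 0 = 0 := max_eq_right (by push_cast; linarith)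
  rw [hm0, zero_div, sub_zero] at hlow
  exact hmargin hlow hR le_rfl (Real.sqrt_nonneg _) hkls

/-- Reduction to `κ ≥ 0` by the `κ ↦ -κ` symmetry. [cite: Koma2022, §4.1] -/
private theorem two_dim_of_nonneg {U g c r : ℝ}
    (hpos : ∀ κ : ℝ, 0 ≤ κ → κ ≤ r → ∃ k₀ : ℕ, ∀ k : ℕ, k₀ ≤ k → ∀ [NeZero (2 * k)],
      c ≤ groundLroSq (hamiltonian κ U g (fun (_ _ : FermionTorus (1 + 1) (2 * k)) => (0 : ℝ)) 0))
    {κ : ℝ} (hκ : |κ| ≤ r) :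
    ∃ k₀ : ℕ, ∀ k : ℕ, k₀ ≤ k → ∀ [NeZero (2 * k)],
      c ≤ groundLroSq (hamiltonian κ U g (fun (_ _ : FermionTorus (1 + 1) (2 * k)) => (0 : ℝ)) 0) := by
  rcases le_or_gt 0 κ with h | h
  · rw [abs_of_nonneg h] at hκ
    exact hpos κ h hκ
  · rw [abs_of_neg h] at hκ
    obtain ⟨k₀, hk₀⟩ := hpos (-κ) (by linarith) hκ
    refine ⟨max k₀ 2, fun k hk _ => ?_⟩
    have h' := hk₀ k (le_trans (le_max_left _ _) hk)
    rwa [groundLroSq_neg_kappa (even_two_mul k) (by omega)] at h'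

/-- **Ground-state pairing long-range order in two dimensions** (Lieb frame): for `g > 0`, `|κ| ≤ g/2000` and
`U + 4g ≤ 0` there is `k₀` such that on every torus `(ℤ/2kℤ)²`, `k ≥ k₀`, the tracial ground state of
`H₀ = H(κ, U; g, 0; 0)` has `|Λ|⁻² Σ_{x,y} Re ω₀(Γ¹_xΓ¹_y) ≥ 1/125`.  Sibling-model statement; not about the Hubbard
model. [cite: KLS1988PRL, eqs. (4)–(8)] [cite: Koma2022, Theorem 2.1 (d ≥ 3, T > 0), (2.13), §6] -/
theorem groundState_superconductingOrder_two {κ U g : ℝ} (hg : 0 < g) (hκg : |κ| ≤ g / 2000) (hU : U + 4 * g ≤ 0) :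
    ∃ k₀ : ℕ, ∀ k : ℕ, k₀ ≤ k → ∀ [NeZero (2 * k)],
      (1 / 125 : ℝ) ≤ groundLroSq (hamiltonian κ U g (fun (_ _ : FermionTorus (1 + 1) (2 * k)) => (0 : ℝ)) 0) := by
  refine two_dim_of_nonneg (fun κ hκ hκr => two_dim_core hg hκ hU fun he hR ht ht0 h => ?_) hκg
  have h4κ : 4 * κ / g ≤ 4 / 2000 := by rw [div_le_iff₀ hg]; linarith
  have hts : Real.sqrt (κ / g) ≤ 0.0224 := by
    rw [show (0.0224 : ℝ) = Real.sqrt (0.0224 ^ 2) by rw [Real.sqrt_sq (by norm_num)]]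
    exact Real.sqrt_le_sqrt (by rw [div_le_iff₀ hg]; nlinarith)
  exact margin_two (by linarith) hR (ht.trans hts) ht0 h

/-- **Ground-state pairing long-range order in two dimensions, small-`κ` window**: `|κ| ≤ g/10000` ⟹
`groundLroSq H₀ ≥ 1/40` on all large even tori. [cite: KLS1988PRL, eqs. (4)–(8)] [cite: Koma2022, Theorem 2.1, (2.13), §6] -/
theorem groundState_superconductingOrder_two_sharp {κ U g : ℝ} (hg : 0 < g) (hκg : |κ| ≤ g / 10000)
    (hU : U + 4 * g ≤ 0) :
    ∃ k₀ : ℕ, ∀ k : ℕ, k₀ ≤ k → ∀ [NeZero (2 * k)],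
      (1 / 40 : ℝ) ≤ groundLroSq (hamiltonian κ U g (fun (_ _ : FermionTorus (1 + 1) (2 * k)) => (0 : ℝ)) 0) := by
  refine two_dim_of_nonneg (fun κ hκ hκr => two_dim_core hg hκ hU fun he hR ht ht0 h => ?_) hκg
  have h4κ : 4 * κ / g ≤ 4 / 10000 := by rw [div_le_iff₀ hg]; linarith
  have hts : Real.sqrt (κ / g) ≤ 1 / 100 := by
    rw [show (1 / 100 : ℝ) = Real.sqrt ((1 / 100) ^ 2) by rw [Real.sqrt_sq (by norm_num)]]
    exact Real.sqrt_le_sqrt (by rw [div_le_iff₀ hg]; linarith)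
  exact margin_two_sharp (by linarith) hR (ht.trans hts) ht0 h

/-- **The printed model, two dimensions, zero temperature**: for Koma's Hamiltonian (2.4)–(2.9) in `d = 2`
(`U = -4g` in the Lieb frame), `g > 0`, `|κ| ≤ g/2000`, on every torus of side `2k ≥ 2k₀` the zero-temperature limit
`lim_{β→∞} m^{(Λ)}_LRO` of the staggered pairing order parameter (2.11) exists and is `≥ 2/25`.
[cite: Koma2022, (2.4)–(2.13), Theorem 2.1 (printed for d ≥ 3)] [cite: KLS1988PRL, eqs. (4)–(8)] -/
theorem printed_groundState_superconductingOrder_two {κ g : ℝ} (hg : 0 < g) (hκg : |κ| ≤ g / 2000) :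
    ∃ k₀ : ℕ, ∀ k : ℕ, k₀ ≤ k → ∀ [NeZero (2 * k)], ∃ m₀ : ℝ, (2 / 25 : ℝ) ≤ m₀ ∧
      Tendsto (fun β : ℝ => mLRO (d := 1) (L := 2 * k) β κ g) atTop (𝓝 m₀) := by
  have hU : (-2 * (1 + 1 : ℕ) * g : ℝ) + 4 * g ≤ 0 := by push_cast; linarith
  obtain ⟨k₀, h⟩ := groundState_superconductingOrder_two hg hκg hU
  refine ⟨max k₀ 2, fun k hk _ => ⟨_, ?_, tendsto_mLRO_atTop (even_two_mul k) (by omega) κ g⟩⟩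
  have h' := h k (le_trans (le_max_left _ _) hk)
  calc (2 / 25 : ℝ) = Real.sqrt ((2 / 25) ^ 2) := (Real.sqrt_sq (by norm_num)).symm
    _ ≤ Real.sqrt (1 / 125) := Real.sqrt_le_sqrt (by norm_num)
    _ ≤ _ := Real.sqrt_le_sqrt h'

/-! ### Two dimensions, `T = 0`: the spontaneous order under the field ((2.15) in `d = 2`) -/

/-- `√(2/125) = 4/√1000`. [cite: Koma2022, (2.15)] -/
theorem sqrt_two_div_125 : Real.sqrt (2 * (1 / 125)) = 4 / Real.sqrt 1000 := by
  rw [show (2 : ℝ) * (1 / 125) = 16 / 1000 by norm_num, Real.sqrt_div' 16 (by norm_num : (0:ℝ) ≤ 1000),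
    show (16 : ℝ) = 4 ^ 2 by norm_num, Real.sqrt_sq (by norm_num : (0:ℝ) ≤ 4)]

/-- **Koma 2022 (2.15) in two dimensions at `T = 0`, Lieb frame, EVERY sourced ground state**: for `g > 0`,
`|κ| ≤ g/2000`, `U + 4g ≤ 0`, every `B > 0` and `ε > 0` there is `k₁` such that on every torus `(ℤ/2kℤ)²`, `k ≥ k₁`,
every unit ground state `Φ_B` of `H₀ - B·Σ_xΓ²_x` (`= hamiltonian κ U g 0 B`) satisfies
`|Λ|⁻¹ Re Φ_B†(Σ_xΓ²_x)Φ_B ≥ 4/√1000 - ε`. [cite: Koma2022, (2.15)] [cite: KomaTasaki1993, Theorem 7.3 (7.11)] [cite: KLS1988PRL, eqs. (4)–(8)] -/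
theorem spontaneousOrder_two {κ U g : ℝ} (hg : 0 < g) (hκg : |κ| ≤ g / 2000) (hU : U + 4 * g ≤ 0) {B ε : ℝ}
    (hB : 0 < B) (hε : 0 < ε) :
    ∃ k₁ : ℕ, ∀ k : ℕ, k₁ ≤ k → ∀ [NeZero (2 * k)],
      ∀ ΦB : Idx 1 (2 * k) → ℂ, star ΦB ⬝ᵥ ΦB = 1 →
        hamiltonian κ U g (fun (_ _ : FermionTorus (1 + 1) (2 * k)) => (0 : ℝ)) B *ᵥ ΦB =
          ((hamiltonian κ U g (fun (_ _ : FermionTorus (1 + 1) (2 * k)) => (0 : ℝ)) B).groundEnergy : ℂ) • ΦB →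
        4 / Real.sqrt 1000 - ε ≤
          (star ΦB ⬝ᵥ (orderParameter *ᵥ ΦB)).re / (Fintype.card (FermionTorus (1 + 1) (2 * k)) : ℝ) := by
  obtain ⟨k₀, hk₀⟩ := groundState_superconductingOrder_two hg hκg hU
  have hlro : ∀ k : ℕ, k₀ ≤ k → ∀ [NeZero (2 * k)],
      (1 / 125 : ℝ) ≤ groundLroSq (hamiltonianC κ U g 0 (fun (_ _ : FermionTorus (1 + 1) (2 * k)) => (0 : ℝ)) 0) :=
    fun k hk _ => by rw [hamiltonianC_zero]; exact hk₀ k hk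
  obtain ⟨k₁, hk₁⟩ := spontaneousOrder_of_groundLroSq (d := 1) (by norm_num) (by norm_num) hlro hB hε
  refine ⟨k₁, fun k hk _ ΦB hΦB hHB => ?_⟩
  rw [← sqrt_two_div_125]
  refine hk₁ k hk ΦB hΦB ?_
  rw [hamiltonianC_zero]
  exact hHB

/-- **(2.13) & (2.15) in two dimensions at `T = 0`, Lieb frame**: the zero-temperature limit
`lim_{β→∞} |Λ|⁻¹Re⟨Σ_xΓ²_x⟩_{β, H₀ - B·O}` exists and is `≥ 4/√1000 - ε` on all large even tori.
[cite: Koma2022, (2.13), (2.15)] [cite: KomaTasaki1993, Theorem 7.3] -/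
theorem spontaneousOrder_two_zeroTemperature {κ U g : ℝ} (hg : 0 < g) (hκg : |κ| ≤ g / 2000) (hU : U + 4 * g ≤ 0)
    {B ε : ℝ} (hB : 0 < B) (hε : 0 < ε) :
    ∃ k₁ : ℕ, ∀ k : ℕ, k₁ ≤ k → ∀ [NeZero (2 * k)], ∃ m : ℝ,
      Tendsto (fun β : ℝ => (gibbsState β
          (hamiltonian κ U g (fun (_ _ : FermionTorus (1 + 1) (2 * k)) => (0 : ℝ)) B) orderParameter).re /
            (Fintype.card (FermionTorus (1 + 1) (2 * k)) : ℝ)) atTop (𝓝 m) ∧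
        4 / Real.sqrt 1000 - ε ≤ m := by
  obtain ⟨k₀, hk₀⟩ := groundState_superconductingOrder_two hg hκg hU
  have hlro : ∀ k : ℕ, k₀ ≤ k → ∀ [NeZero (2 * k)],
      (1 / 125 : ℝ) ≤ groundLroSq (hamiltonianC κ U g 0 (fun (_ _ : FermionTorus (1 + 1) (2 * k)) => (0 : ℝ)) 0) :=
    fun k hk _ => by rw [hamiltonianC_zero]; exact hk₀ k hk
  obtain ⟨k₁, hk₁⟩ := spontaneousOrder_zeroTemperature_of_groundLroSq (d := 1) (by norm_num) (by norm_num) hlro hB hε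
  refine ⟨k₁, fun k hk _ => ?_⟩
  obtain ⟨m, hm, hle⟩ := hk₁ k hk
  refine ⟨m, ?_, by rwa [← sqrt_two_div_125]⟩
  simpa only [hamiltonianC_zero] using hm

/-- **Koma 2022 (2.15), as printed, two dimensions, `T = 0`**: for Koma's Hamiltonian (2.4)–(2.9) in `d = 2`
(`g' = 0`) with `g > 0`, `|κ| ≤ g/2000`, every field `B > 0` and `ε > 0`, on every torus `(ℤ/2kℤ)²`, `k ≥ k₁`, the
finite-volume ground state (2.13) satisfies `|Λ|⁻¹ ω^{(Λ)}_B(O^{(Λ)}) ≥ 4/√1000 - ε`, `O^{(Λ)}` the staggered order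
parameter (2.5). [cite: Koma2022, (2.13)–(2.15)] [cite: KomaTasaki1993, Theorem 7.3 (7.11)] [cite: KLS1988PRL, eqs. (4)–(8)] -/
theorem printed_spontaneousOrder_two {κ g : ℝ} (hg : 0 < g) (hκg : |κ| ≤ g / 2000) {B ε : ℝ} (hB : 0 < B)
    (hε : 0 < ε) :
    ∃ k₁ : ℕ, ∀ k : ℕ, k₁ ≤ k → ∀ [NeZero (2 * k)], ∃ m : ℝ,
      Tendsto (fun β : ℝ => (gibbsState β
          (printedHamiltonian κ g (fun (_ : Fin (1 + 1)) (_ : FermionTorus (1 + 1) (2 * k)) => (0 : ℝ)) B)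
            printedOrder).re / (Fintype.card (FermionTorus (1 + 1) (2 * k)) : ℝ)) atTop (𝓝 m) ∧
        4 / Real.sqrt 1000 - ε ≤ m := by
  have hU : (-2 * (1 + 1 : ℕ) * g : ℝ) + 4 * g ≤ 0 := by push_cast; linarith
  obtain ⟨k₁, hk₁⟩ := spontaneousOrder_two_zeroTemperature hg hκg hU hB hε
  refine ⟨max k₁ 2, fun k hk _ => ?_⟩
  obtain ⟨m, hm, hle⟩ := hk₁ k (le_trans (le_max_left _ _) hk)
  refine ⟨m, ?_, hle⟩
  refine hm.congr' (Eventually.of_forall fun β => ?_)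
  simp only [← printedHamiltonianC_zero, gibbsState_printedOrder_eq (even_two_mul k) (by omega), hamiltonianC_zero]

end KomaPiFlux

end Literature.MathematicalPhysics.QuantumLattice

end
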